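import Summits.QuantumFields.YangMills.Theorems.ToronValleyVolumeZeroModeColumnBounds
import Literature.Probability.Distributions.GaussianSphereMarginal

/-!
# Zero-mode quartic of the toron valley, VI: ONE LOG — `β³ Z₄(β)/log β → A = 3·vol(B₁)·K`
# (BC5 rung `stub_rung_zeroModeLog4` of crux ⟨stmt-QuantumFields-24497⟩ `ToronTubeVolumeLaw`, BY NAME)

Radial assembly (polar coordinates `∫ f(‖a‖) da = 3 vol(B₁) ∫ r² f`, `ℝ≥0∞` form from
`Literature.Probability.Distributions.lintegral_fun_norm_addHaar`) of the column bounds of file V with threshold `ρ = β^{-1/4}`: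
`β³ Z₄(β) ≤ A log β + C₁` for `β ≥ 1` and, for every `0 < θ ≤ 1/2`, `r₁ > 0`, `M`,
`β³ Z₄(β) ≥ 12 vol(B₁) e^{−2r₁²}(1−θ)³ L_M · log(r₁/ρ')`, `ρ' = ((M+1)⁴/(θ²β))^{1/4}`; since `L_M ↑ K` and
`e^{−2δ²}(1−δ)³ → 1`, the lower coefficients approach `A`, so `β³Z₄/log β → A > 0`.
Numerically `A = π⁶` (`K = π³·∫_{[-1,1]³}(1+|w|²)⁻² dw = π⁵/4`), matching kit job j327769's slope `1/64` per unit `log β`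
in the planner's `E[·]`-normalisation (`(2π)⁻⁶ π⁶ = 1/64`).

HONEST LABEL: a plan-only BC5 rung (finite-dimensional singular Laplace asymptotics with one logarithm) of a DRAFT-by-design
sub-route; it is NOT in the composition of the crux `ToronTubeVolumeLaw`; no crux, rung of the ladder, leaf or summit statement
is proved; the Yang–Mills mass gap is NOT proved by this.
-/

noncomputable section

namespace Summit.QuantumFields.YangMills.Theorems.ToronValleyVolume.ZeroMode

open MeasureTheory Real Finset Set
open scoped ENNReal
open Summit.QuantumFields.YangMills.Cruxes.ToronTubeVolumeLaw.Birth

/-! ## §11 Radial assembly of the two bounds -/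

/-- Volume constant `V = (4π/3)³` (cube of the unit-ball volume of `ℝ³`). -/
def Vc : ℝ := (Real.pi * 4 / 3) ^ 3

/-- Auxiliary: `Vc_pos`. -/
theorem Vc_pos : 0 < Vc := by unfold Vc; positivity

/-- `vol(B̄_r)³ = V r⁹` on `ℝ³` (`r ≥ 0`). -/
theorem volume_closedBall_pow_three {r : ℝ} (hr : 0 ≤ r) :
    volume (Metric.closedBall (0 : EuclideanSpace ℝ (Fin 3)) r) ^ 3 = ENNReal.ofReal (Vc * r ^ 9) := by
  rw [EuclideanSpace.volume_closedBall_fin_three, ← ENNReal.ofReal_pow hr, ← ENNReal.ofReal_mul (by positivity),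
    ← ENNReal.ofReal_pow (by positivity)]
  congr 1; unfold Vc; ring

/-- Polar coordinates on `ℝ³` for lower integrals: `∫ f(‖a‖) da = 3·vol(B₁)·∫_{r>0} r² f(r) dr`. -/
theorem lintegral_radial (f : ℝ → ℝ≥0∞) (hf : Measurable f) :
    ∫⁻ a : EuclideanSpace ℝ (Fin 3), f ‖a‖ =
      3 * volume (Metric.ball (0 : EuclideanSpace ℝ (Fin 3)) 1) * ∫⁻ r in Ioi (0 : ℝ), ENNReal.ofReal (r ^ 2) * f r := by
  rw [Literature.Probability.Distributions.lintegral_fun_norm_addHaar volume f hf, finrank_euclideanSpace_fin]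
  norm_num

/-- POINTWISE UPPER PROFILE: `Φ⁺(β,a) ≤ u(‖a‖)` for every threshold `ρ > 0` (`β > 0`). -/
theorem PhiP_le_uprof {β ρ : ℝ} (hβ : 0 < β) (hρ : 0 < ρ) (a : EuclideanSpace ℝ (Fin 3)) :
    PhiP β a ≤ ENNReal.ofReal (uprof KK.toReal Vc β ρ ‖a‖) := by
  unfold uprof
  by_cases h : ‖a‖ ≤ ρ
  · rw [if_pos h]
    calc PhiP β a ≤ ENNReal.ofReal (Real.exp (-‖a‖ ^ 2 / 2)) *
          volume (Metric.closedBall (0 : EuclideanSpace ℝ (Fin 3)) ‖a‖) ^ 3 := PhiP_le_volume hβ.le a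
      _ = _ := by rw [volume_closedBall_pow_three (norm_nonneg a), ← ENNReal.ofReal_mul (Real.exp_pos _).le]
  · rw [if_neg h]
    push Not at h
    have hr : 0 < ‖a‖ := hρ.trans h
    calc PhiP β a = PhiP β (‖a‖ • e3) := PhiP_eq_axis β a
      _ ≤ ENNReal.ofReal (Real.exp (-‖a‖ ^ 2 / 2)) * ENNReal.ofReal (((‖a‖ * β) ^ 3)⁻¹) * KK := PhiP_le_kernel hβ hr
      _ = _ := by
          conv_lhs => rw [← ENNReal.ofReal_toReal KK_ne_top]
          rw [← ENNReal.ofReal_mul (Real.exp_pos _).le, ← ENNReal.ofReal_mul (by positivity)]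
          congr 1; rw [div_eq_mul_inv]; ring

/-- RADIAL UPPER BOUND: `∫ Φ⁺(β,a) da ≤ 3·vol(B₁)·(Vβ⁻³/12 + K β⁻³ (¼ log β + e^{1/2}))` for `β ≥ 1`. -/
theorem lintegral_PhiP_le {β : ℝ} (hβ : 1 ≤ β) :
    ∫⁻ a, PhiP β a ≤ 3 * volume (Metric.ball (0 : EuclideanSpace ℝ (Fin 3)) 1) *
      ENNReal.ofReal (Vc * (β ^ 3)⁻¹ / 12 + KK.toReal / β ^ 3 * (Real.log β / 4 + Real.exp (1 / 2))) := by
  have hβ0 : 0 < β := by linarith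
  -- threshold `ρ = β^{-1/4}`
  set ρ : ℝ := Real.sqrt (Real.sqrt β⁻¹) with hρdef
  have hρ : 0 < ρ := Real.sqrt_pos.2 (Real.sqrt_pos.2 (inv_pos.2 hβ0))
  have hρ4 : ρ ^ 4 = β⁻¹ := by
    rw [show ρ ^ 4 = (ρ ^ 2) ^ 2 by ring, hρdef, Real.sq_sqrt (Real.sqrt_nonneg _),
      Real.sq_sqrt (inv_nonneg.2 hβ0.le)]
  have hρ1 : ρ ≤ 1 := by
    by_contra hcon; push Not at hcon
    have : 1 < ρ ^ 4 := one_lt_pow₀ hcon (by norm_num)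
    rw [hρ4] at this
    exact absurd (inv_le_one_of_one_le₀ hβ) (not_le.2 this)
  have hlog : Real.log ρ⁻¹ = Real.log β / 4 := by
    rw [Real.log_inv, hρdef, Real.log_sqrt (Real.sqrt_nonneg _), Real.log_sqrt (inv_nonneg.2 hβ0.le), Real.log_inv]
    ring
  have hρ12 : ρ ^ 12 = (β ^ 3)⁻¹ := by rw [show ρ ^ 12 = (ρ ^ 4) ^ 3 by ring, hρ4, inv_pow]
  calc ∫⁻ a, PhiP β a ≤ ∫⁻ a : EuclideanSpace ℝ (Fin 3), ENNReal.ofReal (uprof KK.toReal Vc β ρ ‖a‖) :=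
        lintegral_mono fun a => PhiP_le_uprof hβ0 hρ a
    _ = 3 * volume (Metric.ball (0 : EuclideanSpace ℝ (Fin 3)) 1) *
          ∫⁻ r in Ioi (0 : ℝ), ENNReal.ofReal (r ^ 2) * ENNReal.ofReal (uprof KK.toReal Vc β ρ r) :=
        lintegral_radial (fun r => ENNReal.ofReal (uprof KK.toReal Vc β ρ r))
          (ENNReal.measurable_ofReal.comp (measurable_uprof _ _ _ _))
    _ ≤ 3 * volume (Metric.ball (0 : EuclideanSpace ℝ (Fin 3)) 1) *
          ENNReal.ofReal (Vc * ρ ^ 12 / 12 + KK.toReal / β ^ 3 * (Real.log ρ⁻¹ + Real.exp (1 / 2))) := by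
        gcongr
        exact lintegral_uprof_le ENNReal.toReal_nonneg Vc_pos.le hβ0 hρ hρ1
    _ = _ := by rw [hρ12, hlog]

/-- ★ UPPER BOUND ON `Z₄`: `β³ Z₄(β) ≤ A log β + C₁` for `β ≥ 1`, with `A = 3·vol(B₁)·K`. -/
theorem zeroModeZ_upper {β : ℝ} (hβ : 1 ≤ β) :
    β ^ 3 * zeroModeZ 4 β ≤
      3 * (volume (Metric.ball (0 : EuclideanSpace ℝ (Fin 3)) 1)).toReal * KK.toReal * Real.log β +
        (volume (Metric.ball (0 : EuclideanSpace ℝ (Fin 3)) 1)).toReal * (Vc + 12 * KK.toReal * Real.exp (1 / 2)) := by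
  have hβ0 : 0 < β := by linarith
  set vB := volume (Metric.ball (0 : EuclideanSpace ℝ (Fin 3)) 1) with hvB
  have hvB_top : vB ≠ ⊤ := measure_ball_lt_top.ne
  set E : ℝ := Vc * (β ^ 3)⁻¹ / 12 + KK.toReal / β ^ 3 * (Real.log β / 4 + Real.exp (1 / 2)) with hE
  have hE0 : 0 ≤ E := by
    have := Real.log_nonneg hβ; have := Vc_pos; positivity
  have h1 : ∫⁻ c, F4 β c ≤ 4 * (3 * vB * ENNReal.ofReal E) :=
    (lintegral_F4_le_four_PhiP β).trans (by have := lintegral_PhiP_le hβ; gcongr)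
  have h2 : zeroModeZ 4 β ≤ (4 * (3 * vB * ENNReal.ofReal E)).toReal := by
    rw [zeroModeZ_eq_toReal 4 hβ0.le]
    exact ENNReal.toReal_mono (by
      refine ENNReal.mul_ne_top (by norm_num) (ENNReal.mul_ne_top (ENNReal.mul_ne_top (by norm_num) hvB_top)
        ENNReal.ofReal_ne_top)) h1
  rw [ENNReal.toReal_mul, ENNReal.toReal_mul, ENNReal.toReal_mul, ENNReal.toReal_ofReal hE0] at h2
  norm_num at h2
  have h3 : β ^ 3 * zeroModeZ 4 β ≤ β ^ 3 * (4 * (3 * vB.toReal * E)) := mul_le_mul_of_nonneg_left h2 (by positivity)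
  refine h3.trans (le_of_eq ?_)
  rw [hE]
  field_simp
  ring

/-- The lower threshold constant `C_M = (M+1)⁴/θ²`. -/
def Cth (M : ℕ) (θ : ℝ) : ℝ := ((M : ℝ) + 1) ^ 4 / θ ^ 2

/-- Auxiliary: `Cth_pos`. -/
theorem Cth_pos (M : ℕ) {θ : ℝ} (hθ : 0 < θ) : 0 < Cth M θ := by unfold Cth; positivity

/-- POINTWISE LOWER PROFILE on the shell `ρ' ≤ ‖a‖ ≤ r₁`, `ρ' = (C_M/β)^{1/4}`. -/
theorem lprof_le_PhiM {β r₁ θ : ℝ} (hβ : 0 < β) (hθ : 0 < θ) (hθ1 : θ ≤ 1 / 2) (M : ℕ) (a : EuclideanSpace ℝ (Fin 3)) :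
    (ENNReal.ofReal (Real.exp (-(2 * r₁ ^ 2)) * (1 - θ) ^ 3) * LL M) *
        (Icc (Real.sqrt (Real.sqrt (Cth M θ / β))) r₁).indicator
          (fun r => ENNReal.ofReal (((r * β) ^ 3)⁻¹)) ‖a‖ ≤ PhiM β a := by
  set ρ' := Real.sqrt (Real.sqrt (Cth M θ / β)) with hρ'
  by_cases ha : ‖a‖ ∈ Icc ρ' r₁
  · rw [indicator_of_mem ha]
    have hρpos : 0 < ρ' := Real.sqrt_pos.2 (Real.sqrt_pos.2 (div_pos (Cth_pos M hθ) hβ))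
    have hr : 0 < ‖a‖ := hρpos.trans_le ha.1
    have hρ4 : ρ' ^ 4 = Cth M θ / β := by
      rw [show ρ' ^ 4 = (ρ' ^ 2) ^ 2 by ring, hρ', Real.sq_sqrt (Real.sqrt_nonneg _),
        Real.sq_sqrt (div_pos (Cth_pos M hθ) hβ).le]
    have hM : ((M : ℝ) + 1) ^ 4 / θ ^ 2 ≤ β * ‖a‖ ^ 4 := by
      have h1 : ρ' ^ 4 ≤ ‖a‖ ^ 4 := pow_le_pow_left₀ hρpos.le ha.1 4
      rw [hρ4, div_le_iff₀ hβ] at h1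
      unfold Cth at h1; linarith
    calc _ = ENNReal.ofReal (Real.exp (-(2 * r₁ ^ 2))) * ENNReal.ofReal ((1 - θ) ^ 3 * ((‖a‖ * β) ^ 3)⁻¹) * LL M := by
          rw [ENNReal.ofReal_mul (Real.exp_pos _).le, ENNReal.ofReal_mul (by
            have : 0 < 1 - θ := by linarith
            positivity)]
          ring
      _ ≤ PhiM β (‖a‖ • e3) := kernel_le_PhiM hβ hr ha.2 hθ hθ1 M hM
      _ = PhiM β a := (PhiM_eq_axis β a).symm
  · rw [indicator_of_notMem ha, mul_zero]; exact zero_le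

/-- ★ LOWER BOUND ON `Z₄`: for `0 < θ ≤ 1/2`, `r₁ > 0`, `M`, and `β > 0` with `C_M/β ≤ r₁⁴`,
`β³ Z₄(β) ≥ 12·vol(B₁)·e^{−2r₁²}(1−θ)³ L_M · log(r₁/ρ')`, `ρ' = (C_M/β)^{1/4}`. -/
theorem zeroModeZ_lower {β r₁ θ : ℝ} (hβ : 0 < β) (hr₁ : 0 < r₁) (hθ : 0 < θ) (hθ1 : θ ≤ 1 / 2) (M : ℕ)
    (hβC : Cth M θ / β ≤ r₁ ^ 4) :
    12 * (volume (Metric.ball (0 : EuclideanSpace ℝ (Fin 3)) 1)).toReal *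
        (Real.exp (-(2 * r₁ ^ 2)) * (1 - θ) ^ 3) * (LL M).toReal *
        Real.log (r₁ / Real.sqrt (Real.sqrt (Cth M θ / β))) ≤ β ^ 3 * zeroModeZ 4 β := by
  set ρ' := Real.sqrt (Real.sqrt (Cth M θ / β)) with hρ'
  set vB := volume (Metric.ball (0 : EuclideanSpace ℝ (Fin 3)) 1) with hvB
  have hvB_top : vB ≠ ⊤ := measure_ball_lt_top.ne
  have hCpos := Cth_pos M hθ
  have hρpos : 0 < ρ' := Real.sqrt_pos.2 (Real.sqrt_pos.2 (div_pos hCpos hβ))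
  have hρ4 : ρ' ^ 4 = Cth M θ / β := by
    rw [show ρ' ^ 4 = (ρ' ^ 2) ^ 2 by ring, hρ', Real.sq_sqrt (Real.sqrt_nonneg _), Real.sq_sqrt (div_pos hCpos hβ).le]
  have hρr : ρ' ≤ r₁ := by
    by_contra hcon; push Not at hcon
    have : r₁ ^ 4 < ρ' ^ 4 := pow_lt_pow_left₀ hcon hr₁.le (by norm_num)
    rw [hρ4] at this; linarith
  set Cst : ℝ≥0∞ := ENNReal.ofReal (Real.exp (-(2 * r₁ ^ 2)) * (1 - θ) ^ 3) * LL M with hCst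
  have hLL_top : LL M ≠ ⊤ := (lt_of_le_of_lt (LL_le_KK M) KK_lt_top).ne
  -- radial lower bound in `ℝ≥0∞`
  have h1 : Cst * (3 * vB * ENNReal.ofReal ((β ^ 3)⁻¹ * Real.log (r₁ / ρ'))) ≤ ∫⁻ a, PhiM β a := by
    have hmeas : Measurable (fun r : ℝ => (Icc ρ' r₁).indicator (fun r => ENNReal.ofReal (((r * β) ^ 3)⁻¹)) r) :=
      (ENNReal.measurable_ofReal.comp (by fun_prop)).indicator measurableSet_Icc
    calc Cst * (3 * vB * ENNReal.ofReal ((β ^ 3)⁻¹ * Real.log (r₁ / ρ')))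
        = Cst * ∫⁻ a : EuclideanSpace ℝ (Fin 3),
            (Icc ρ' r₁).indicator (fun r => ENNReal.ofReal (((r * β) ^ 3)⁻¹)) ‖a‖ := by
          rw [lintegral_radial _ hmeas, ← lintegral_lprof_eq hβ hρpos hρr]
      _ = ∫⁻ a : EuclideanSpace ℝ (Fin 3),
            Cst * (Icc ρ' r₁).indicator (fun r => ENNReal.ofReal (((r * β) ^ 3)⁻¹)) ‖a‖ := by
          rw [lintegral_const_mul]
          exact hmeas.comp measurable_norm
      _ ≤ ∫⁻ a, PhiM β a := lintegral_mono fun a => lprof_le_PhiM hβ hθ hθ1 M a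
  have h2 : 4 * (Cst * (3 * vB * ENNReal.ofReal ((β ^ 3)⁻¹ * Real.log (r₁ / ρ')))) ≤ ∫⁻ c, F4 β c :=
    le_trans (by gcongr) (four_PhiM_le_lintegral_F4 β)
  have h3 : (4 * (Cst * (3 * vB * ENNReal.ofReal ((β ^ 3)⁻¹ * Real.log (r₁ / ρ'))))).toReal ≤ zeroModeZ 4 β := by
    rw [zeroModeZ_eq_toReal 4 hβ.le]
    exact ENNReal.toReal_mono (lintegral_zmI_lt_top 4 hβ.le).ne h2
  have hlog : 0 ≤ Real.log (r₁ / ρ') := Real.log_nonneg ((one_le_div hρpos).2 hρr)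
  have hθ' : 0 < 1 - θ := by linarith
  rw [hCst, ENNReal.toReal_mul, ENNReal.toReal_mul, ENNReal.toReal_mul, ENNReal.toReal_mul, ENNReal.toReal_mul,
    ENNReal.toReal_ofReal (by positivity), ENNReal.toReal_ofReal (by positivity)] at h3
  norm_num at h3
  have h4 := mul_le_mul_of_nonneg_left h3 (show (0 : ℝ) ≤ β ^ 3 by positivity)
  refine le_trans (le_of_eq ?_) h4
  field_simp
  ring

/-! ## §12 The limit -/

/-- The limit constant `A = 3 · vol(B₁) · K`. -/
def Acst : ℝ := 3 * (volume (Metric.ball (0 : EuclideanSpace ℝ (Fin 3)) 1)).toReal * KK.toReal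

/-- Auxiliary: `Acst_pos`. -/
theorem Acst_pos : 0 < Acst := by
  unfold Acst
  have h1 : 0 < (volume (Metric.ball (0 : EuclideanSpace ℝ (Fin 3)) 1)).toReal :=
    ENNReal.toReal_pos (Metric.measure_ball_pos volume _ zero_lt_one).ne' measure_ball_lt_top.ne
  have h2 : 0 < KK.toReal := ENNReal.toReal_pos KK_ne_zero KK_ne_top
  positivity

/-- `L_M → K` in `ℝ` (monotone convergence). -/
theorem tendsto_LL_toReal : Filter.Tendsto (fun M => (LL M).toReal) Filter.atTop (nhds KK.toReal) := by
  have h1 : Filter.Tendsto LL Filter.atTop (nhds KK) := by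
    rw [← iSup_LL]
    exact tendsto_atTop_iSup fun M N h => lintegral_mono (lam_mono h)
  exact (ENNReal.tendsto_toReal KK_ne_top).comp h1

/-- The correction factor `g(δ) = e^{−2δ²}(1−δ)³ → 1` as `δ → 0`. -/
theorem tendsto_corr : Filter.Tendsto (fun δ : ℝ => Real.exp (-(2 * δ ^ 2)) * (1 - δ) ^ 3) (nhds 0) (nhds 1) := by
  have h := (by fun_prop : Continuous (fun δ : ℝ => Real.exp (-(2 * δ ^ 2)) * (1 - δ) ^ 3)).tendsto 0
  simpa using h

/-- For every `q < A` there are admissible parameters whose lower coefficient exceeds `q`. -/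
theorem exists_params {q : ℝ} (hq : q < Acst) :
    ∃ (M : ℕ) (δ : ℝ), 0 < δ ∧ δ ≤ 1 / 2 ∧
      q < 3 * (volume (Metric.ball (0 : EuclideanSpace ℝ (Fin 3)) 1)).toReal *
        (Real.exp (-(2 * δ ^ 2)) * (1 - δ) ^ 3) * (LL M).toReal := by
  set vB := (volume (Metric.ball (0 : EuclideanSpace ℝ (Fin 3)) 1)).toReal with hvB
  -- WLOG `q ≥ A/2 > 0`
  set q' := max q (Acst / 2) with hq'
  have hq'A : q' < Acst := max_lt hq (by linarith [Acst_pos])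
  have hq'pos : 0 < q' := lt_of_lt_of_le (by linarith [Acst_pos]) (le_max_right _ _)
  -- choose `M`
  have hM : ∀ᶠ M in Filter.atTop, (q' + Acst) / 2 < 3 * vB * (LL M).toReal := by
    have ht : Filter.Tendsto (fun M => 3 * vB * (LL M).toReal) Filter.atTop (nhds Acst) := by
      unfold Acst; exact tendsto_LL_toReal.const_mul _
    exact ht.eventually_const_lt (by linarith)
  obtain ⟨M, hM⟩ := hM.exists
  -- choose `δ`
  set q₁ := 3 * vB * (LL M).toReal with hq₁
  have hq₁pos : 0 < q₁ := by linarith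
  have hratio : q' / q₁ < 1 := (div_lt_one hq₁pos).2 (by linarith)
  have hδ : ∀ᶠ δ in nhds (0 : ℝ), q' / q₁ < Real.exp (-(2 * δ ^ 2)) * (1 - δ) ^ 3 :=
    tendsto_corr.eventually_const_lt hratio
  have hδ' : ∀ᶠ δ in nhdsWithin (0 : ℝ) (Ioi 0), q' / q₁ < Real.exp (-(2 * δ ^ 2)) * (1 - δ) ^ 3 ∧ δ ∈ Ioc (0 : ℝ) (1 / 2) :=
    (hδ.filter_mono nhdsWithin_le_nhds).and
      (Filter.eventually_of_mem (Ioc_mem_nhdsGT (by norm_num : (0 : ℝ) < 1 / 2)) fun x hx => hx)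
  obtain ⟨δ, hδ1, hδ2⟩ := hδ'.exists
  refine ⟨M, δ, hδ2.1, hδ2.2, ?_⟩
  have : q' < q₁ * (Real.exp (-(2 * δ ^ 2)) * (1 - δ) ^ 3) := by
    have := (div_lt_iff₀ hq₁pos).1 hδ1; linarith
  calc q ≤ q' := le_max_left _ _
    _ < q₁ * (Real.exp (-(2 * δ ^ 2)) * (1 - δ) ^ 3) := this
    _ = _ := by rw [hq₁]; ring

/-- ★★ THE ONE-LOG LAW: `β³ Z₄(β) / log β → A = 3·vol(B₁)·K > 0`. -/
theorem tendsto_zeroModeZ_four :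
    Filter.Tendsto (fun β : ℝ => β ^ 3 * zeroModeZ 4 β / Real.log β) Filter.atTop (nhds Acst) := by
  have hvB : 0 ≤ (volume (Metric.ball (0 : EuclideanSpace ℝ (Fin 3)) 1)).toReal := ENNReal.toReal_nonneg
  rw [tendsto_order]
  constructor
  · -- lower: eventually above any `q < A`
    intro q hq
    obtain ⟨M, δ, hδ0, hδ1, hcoef⟩ := exists_params hq
    set c := 3 * (volume (Metric.ball (0 : EuclideanSpace ℝ (Fin 3)) 1)).toReal *
      (Real.exp (-(2 * δ ^ 2)) * (1 - δ) ^ 3) * (LL M).toReal with hc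
    -- constants of the lower bound
    set C := Cth M δ with hC
    have hCpos : 0 < C := Cth_pos M hδ0
    set d := 4 * c * (Real.log δ - Real.log C / 4) with hd
    have hlim : Filter.Tendsto (fun β : ℝ => c + d / Real.log β) Filter.atTop (nhds (c + 0)) :=
      tendsto_const_nhds.add (tendsto_const_nhds.div_atTop Real.tendsto_log_atTop)
    rw [add_zero] at hlim
    have hev1 : ∀ᶠ β : ℝ in Filter.atTop, q < c + d / Real.log β := hlim.eventually_const_lt hcoef
    have hev2 : ∀ᶠ β : ℝ in Filter.atTop, C / δ ^ 4 ≤ β := Filter.eventually_ge_atTop _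
    have hev3 : ∀ᶠ β : ℝ in Filter.atTop, (2 : ℝ) ≤ β := Filter.eventually_ge_atTop _
    filter_upwards [hev1, hev2, hev3] with β h1 h2 h3
    have hβ : 0 < β := by linarith
    have hlogβ : 0 < Real.log β := Real.log_pos (by linarith)
    have hβC : C / β ≤ δ ^ 4 := by
      rw [div_le_iff₀ hβ]; rw [div_le_iff₀ (by positivity)] at h2; linarith
    have hlow := zeroModeZ_lower hβ hδ0 hδ0 hδ1 M hβC
    -- `log(r₁/ρ') = log β/4 + log δ − log C/4`
    have hlogeq : Real.log (δ / Real.sqrt (Real.sqrt (C / β))) = Real.log β / 4 + (Real.log δ - Real.log C / 4) := by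
      rw [Real.log_div hδ0.ne' (Real.sqrt_pos.2 (Real.sqrt_pos.2 (div_pos hCpos hβ))).ne',
        Real.log_sqrt (Real.sqrt_nonneg _), Real.log_sqrt (div_pos hCpos hβ).le, Real.log_div hCpos.ne' hβ.ne']
      ring
    rw [← hC, hlogeq] at hlow
    refine h1.trans_le ?_
    rw [le_div_iff₀ hlogβ]
    calc (c + d / Real.log β) * Real.log β = c * Real.log β + d := by field_simp
      _ = 12 * (volume (Metric.ball (0 : EuclideanSpace ℝ (Fin 3)) 1)).toReal *
            (Real.exp (-(2 * δ ^ 2)) * (1 - δ) ^ 3) * (LL M).toReal *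
            (Real.log β / 4 + (Real.log δ - Real.log C / 4)) := by rw [hd, hc]; ring
      _ ≤ β ^ 3 * zeroModeZ 4 β := hlow
  · -- upper: eventually below any `q > A`
    intro q hq
    set C₁ := (volume (Metric.ball (0 : EuclideanSpace ℝ (Fin 3)) 1)).toReal *
      (Vc + 12 * KK.toReal * Real.exp (1 / 2)) with hC₁
    have hlim : Filter.Tendsto (fun β : ℝ => Acst + C₁ / Real.log β) Filter.atTop (nhds (Acst + 0)) :=
      tendsto_const_nhds.add (tendsto_const_nhds.div_atTop Real.tendsto_log_atTop)
    rw [add_zero] at hlim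
    have hev1 : ∀ᶠ β : ℝ in Filter.atTop, Acst + C₁ / Real.log β < q := hlim.eventually_lt_const hq
    have hev3 : ∀ᶠ β : ℝ in Filter.atTop, (2 : ℝ) ≤ β := Filter.eventually_ge_atTop _
    filter_upwards [hev1, hev3] with β h1 h3
    have hlogβ : 0 < Real.log β := Real.log_pos (by linarith)
    have hup := zeroModeZ_upper (show (1 : ℝ) ≤ β by linarith)
    refine lt_of_le_of_lt ?_ h1
    rw [div_le_iff₀ hlogβ]
    calc β ^ 3 * zeroModeZ 4 β
        ≤ 3 * (volume (Metric.ball (0 : EuclideanSpace ℝ (Fin 3)) 1)).toReal * KK.toReal * Real.log β + C₁ := hup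
      _ = (Acst + C₁ / Real.log β) * Real.log β := by unfold Acst; field_simp

end Summit.QuantumFields.YangMills.Theorems.ToronValleyVolume.ZeroMode

/-! ## §13 The rung BY NAME (namespace of the registered skeleton `bc/g15-B/ToronTubeVolumeLaw_birth.lean`) -/

namespace Summit.QuantumFields.YangMills.Cruxes.ToronTubeVolumeLaw.Birth

open Filter Topology
open Summit.QuantumFields.YangMills.Theorems.ToronValleyVolume.ZeroMode

/-- ★★★ THE RUNG (`stub_rung_zeroModeLog4` of the registered skeleton, verbatim statement): the Gaussian-regularised
periodic `su(2)` zero-mode block `k = 4` has exactly ONE LOG — `β³ Z₄(β)/log β → A` with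
`A = 3·vol(B₁(ℝ³))·K > 0`, `K = ∫_{|w_μ|≤1} ∫ exp(−Σ|q_μ|² − Σ_{μ<ν}|w_νq_μ − w_μq_ν|²) dq dw`
(real log-canonical threshold `3` with multiplicity `2` of the commuting variety of `(ℝ³)⁴`). -/
theorem stub_rung_zeroModeLog4 :
    ∃ A : ℝ, 0 < A ∧ Tendsto (fun β : ℝ => β ^ 3 * zeroModeZ 4 β / Real.log β) atTop (𝓝 A) :=
  ⟨Acst, Acst_pos, tendsto_zeroModeZ_four⟩

end Summit.QuantumFields.YangMills.Cruxes.ToronTubeVolumeLaw.Birth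

end
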